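import Literature.Analysis.FluidPDE.KochTataruSymbol
import Literature.Analysis.FluidPDE.KochTataruEnergy
import Literature.Analysis.FunctionSpaces.BMOCarlesonFeffermanStein
import HarnessLib

/-!
# The scalar heat potential on the Fourier side: Koch–Tataru's (21) integrated over frequencies

Analysis/FluidPDE proof companion of `Literature/Analysis/FluidPDE/KochTataru.lean` and
`KochTataruCarleson.lean`: the one named fact left in the bilinear estimate (L1) — hence in (T1)
existence and (T2) uniqueness for the integral equation — is the near-field `L²` estimate
`kochTataruBilinear_nearCarleson` (Koch–Tataru, Adv. Math. 157 (2001), (13); Steps 3–5, or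
Remark 3.3 (M. Struwe): (20) `‖Vf‖_∞ ≤ c‖f‖_Y` and (21) `‖∇Vf‖²₂ ≤ ‖f‖₁ ‖Vf‖_∞`). After
expanding `B(u,v)` in an orthonormal basis, (13) reduces — through the kernel symbol
(`KochTataruKernelFourier.lean`) and the `ℓ²` bound on it (`KochTataruSymbol.lean`) — to a
statement about **scalar** sources `g(s,y) = uₖ(s,y) vₗ(s,y)` and their heat potentials
`W = Vg`, `W(t,x) = ∫₀ᵗ∫ G_{t-s}(x-y) g(s,y) dy ds`. This file proves that statement, for jointly
measurable `g` dominated by `Λ 1_N(y)` with `|N| < ∞` (the bounded, boundedly supported sources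
to which the general case reduces by cut-off and truncation), everything **proved** and with no
new definitions:

* `lintegral_freq_energy_duhamelFourier_le` (**(21) integrated in `ξ`, with Parseval**): if
  `|W| ≤ P` on `(0,T) × E` then
  `∫ (2π)²|ξ|² (∫₀ᵀ |Ŵ(t,ξ)|² dt) dξ ≤ P ∫₀ᵀ∫ |g| dx dt` (`ℝ≥0∞`), where
  `Ŵ(t,ξ) = ∫₀ᵗ e^{-(2π)²(t-s)|ξ|²} ĝ(s,ξ) ds`; since `(2π)²|ξ|²|Ŵ|² = |𝓕(∇W)|²` this is
  `∫₀ᵀ‖∇Vg‖²₂ ≤ ‖Vg‖_∞ ‖g‖_{L¹}`, Koch–Tataru's (21) with (15);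
* the way there: slices `g(s,·) ∈ L¹ ∩ L² ∩ L^∞` and their transforms (`norm_fourier_slice_le`,
  `stronglyMeasurable_fourier_slice`, `lintegral_enorm_sq_fourier_slice` = Plancherel);
  `Ŵ` is bounded and jointly measurable and obeys the frequency-wise energy inequality
  (`energy_duhamelFourier`, from `KochTataruEnergy.mul_setIntegral_norm_sq_duhamelExp_le` with
  `a = (2π)²|ξ|²`); the heat-potential integrand is integrable on `(0,t) × E × E`
  (`integrable_heatPotentialIntegrand`, Tonelli and `∫G = 1`), `W(t,·) ∈ L¹(E)` and
  **`𝓕(W(t,·)) = Ŵ(t,·)`** (`fourier_heatPotential`: Fubini in `(x,s)`, the convolution theorem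
  and `𝓕G_τ = e^{-(2π)²τ|ξ|²}`); `conj(Ŵ) ĝ ∈ L¹((0,T) × E_ξ)`
  (`integrable_conj_duhamelFourier_mul`: Cauchy–Schwarz across frequencies and Plancherel for the
  slices, `∫|ĝ(s,ξ)||ĝ(t,ξ)|dξ ≤ Λ²|N|`), so that the `t`- and `ξ`-integrals commute; and Parseval on
  each slice, `Re ∫ conj(Ŵ(t,ξ))ĝ(t,ξ)dξ = ∫ W(t,x)g(t,x)dx ≤ P∫|g(t,·)|`
  (`re_integral_conj_duhamelFourier_mul_eq`, `integral_heatPotential_mul_le`).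

Design: hypotheses are carried explicitly (`Measurable (uncurry g)`, `|g s y| ≤ Λ 1_N(y)`,
`MeasurableSet N`, `volume N < ∞`) rather than bundled, and all objects are written out (no
definitions), so that the statements can be instantiated verbatim on the components
`⟪e_k, u⟫⟪e_l, v⟫` of cut-off fields. `KochTataruFourierSlice.lean` computes the same transform of
the heat potential in product-integral form (`fourier_heatPotential_slice`); here the iterated form
matching `KochTataruEnergy` is used.

## Mathlib / tree search

Tree: `KochTataruEnergy.lean` (`norm_duhamelExp_le`, `mul_setIntegral_norm_sq_duhamelExp_le`),
`KochTataruSymbol.lean` (`re_integral_conj_fourier_mul_eq`, `memLp_two_of_integrable_of_bound`),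
`FunctionSpaces.lintegral_enorm_sq_fourierIntegral_eq`, `continuous_fourierIntegral`
(`PlancherelL1L2`), `BMOInv.fourier_ofReal_heatKernel`, `enorm_ofReal_complex`
(`BMOCarlesonFeffermanStein`), `lintegral_enorm_heatKernel`, `integrable_heatKernel_holds`,
`measurable_heatKernel_uncurry`. Mathlib: `StronglyMeasurable.integral_prod_right`,
`Measurable.lintegral_prod_right'`, `integral_integral_swap`, `Integrable.integral_prod_left/right`,
`integrable_prod_iff`, `lintegral_prod`, `lintegral_lintegral_swap`,
`ENNReal.lintegral_mul_le_Lp_mul_Lq`, `Real.fourier_mul_convolution_eq`,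
`VectorFourier.norm_fourierIntegral_le_integral_norm`, `Measure.integrableOn_of_bounded`,
`ofReal_integral_eq_lintegral_ofReal`, `integral_re`, `Measure.prod_restrict`. Nothing is
duplicated (`lean search 'duhamelFourier|heatPotentialIntegrand|fourier_slice|freq_energy'`).

## References

* H. Koch, D. Tataru, *Well-posedness for the Navier–Stokes equations*, Adv. Math. 157 (2001)
  22–35, §3: Lemma 3.2 Step 3 ((13), (15)), Remark 3.3 ((20), (21)). Bib key
  `KochTataruAdvMath2001` (held: doi:10.1006/aima.2000.1937, pp. 7–9 of the preprint).
-/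

noncomputable section

open MeasureTheory Set Function Filter Topology Metric Real
open scoped ENNReal NNReal RealInnerProductSpace FourierTransform ComplexConjugate Convolution

namespace Literature.Analysis.FluidPDE

open UnboundedOperators (heatKernel heatSymbol heatKernel_pos)

variable {E : Type*} [NormedAddCommGroup E] [InnerProductSpace ℝ E] [FiniteDimensional ℝ E]
  [MeasurableSpace E] [BorelSpace E]

/-! ## Bounded, boundedly supported scalar sources: slices and their Fourier transforms -/

section Slices

variable {g : ℝ → E → ℝ} {Λ : ℝ} {N : Set E}

/-- The dominating function `Λ 1_N` is integrable when `N` has finite measure. [folklore] -/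
theorem integrable_const_mul_indicator (hN : MeasurableSet N) (hNv : volume N < ∞) (Λ : ℝ) :
    Integrable (fun y : E => Λ * N.indicator (1 : E → ℝ) y) := by
  have h : (fun y : E => Λ * N.indicator (1 : E → ℝ) y) = N.indicator (fun _ => Λ) := by
    funext y; simp only [indicator, Pi.one_apply]; split_ifs <;> simp
  rw [h, integrable_indicator_iff hN]
  exact integrableOn_const hNv.ne

/-- `∫ Λ 1_N = Λ |N|`. [folklore] -/
theorem integral_const_mul_indicator (hN : MeasurableSet N) (Λ : ℝ) :
    ∫ y : E, Λ * N.indicator (1 : E → ℝ) y = Λ * volume.real N := by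
  have h : (fun y : E => Λ * N.indicator (1 : E → ℝ) y) = N.indicator (fun _ => Λ) := by
    funext y; simp only [indicator, Pi.one_apply]; split_ifs <;> simp
  rw [h, integral_indicator_const Λ hN, smul_eq_mul, mul_comm]

omit [NormedAddCommGroup E] [InnerProductSpace ℝ E] [FiniteDimensional ℝ E] [MeasurableSpace E]
  [BorelSpace E] in
/-- A slice of a source dominated by `Λ 1_N` is bounded by `Λ`. [folklore] -/
theorem abs_le_of_le_indicator (hΛ : ∀ s y, |g s y| ≤ Λ * N.indicator (1 : E → ℝ) y) (hΛ0 : 0 ≤ Λ)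
    (s : ℝ) (y : E) : |g s y| ≤ Λ := by
  refine (hΛ s y).trans ?_
  simp only [indicator, Pi.one_apply]
  split_ifs <;> nlinarith

/-- **Slices are integrable**: `g(s, ·) ∈ L¹(E)` with `∫ |g(s, ·)| ≤ Λ |N|`. [folklore] -/
theorem integrable_slice (hg : Measurable (uncurry g)) (hN : MeasurableSet N) (hNv : volume N < ∞)
    (hΛ : ∀ s y, |g s y| ≤ Λ * N.indicator (1 : E → ℝ) y) (s : ℝ) : Integrable (g s) :=
  (integrable_const_mul_indicator hN hNv Λ).mono' (hg.of_uncurry_left).aestronglyMeasurable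
    (Eventually.of_forall fun y => by rw [Real.norm_eq_abs]; exact hΛ s y)

/-- `∫ |g(s, ·)| ≤ Λ |N|`. [folklore] -/
theorem integral_abs_slice_le (hg : Measurable (uncurry g)) (hN : MeasurableSet N) (hNv : volume N < ∞)
    (hΛ : ∀ s y, |g s y| ≤ Λ * N.indicator (1 : E → ℝ) y) (s : ℝ) :
    ∫ y, |g s y| ≤ Λ * volume.real N := by
  rw [← integral_const_mul_indicator hN Λ]
  exact integral_mono (integrable_slice hg hN hNv hΛ s).abs (integrable_const_mul_indicator hN hNv Λ)
    fun y => hΛ s y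

/-- The complexified slice is integrable. [folklore] -/
theorem integrable_ofReal_slice (hg : Measurable (uncurry g)) (hN : MeasurableSet N) (hNv : volume N < ∞)
    (hΛ : ∀ s y, |g s y| ≤ Λ * N.indicator (1 : E → ℝ) y) (s : ℝ) :
    Integrable (fun y => (g s y : ℂ)) :=
  (integrable_slice hg hN hNv hΛ s).ofReal

/-- The complexified slice is square integrable (`L¹ ∩ L^∞ ⊆ L²`). [folklore] -/
theorem memLp_two_ofReal_slice (hg : Measurable (uncurry g)) (hN : MeasurableSet N) (hNv : volume N < ∞)
    (hΛ : ∀ s y, |g s y| ≤ Λ * N.indicator (1 : E → ℝ) y) (hΛ0 : 0 ≤ Λ) (s : ℝ) :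
    MemLp (fun y => (g s y : ℂ)) 2 volume :=
  memLp_two_of_integrable_of_bound (integrable_ofReal_slice hg hN hNv hΛ s) fun y => by
    rw [Complex.norm_real, Real.norm_eq_abs]; exact abs_le_of_le_indicator hΛ hΛ0 s y

/-- **The Fourier transform of a slice is bounded by `Λ |N|`**. [folklore] -/
theorem norm_fourier_slice_le (hg : Measurable (uncurry g)) (hN : MeasurableSet N) (hNv : volume N < ∞)
    (hΛ : ∀ s y, |g s y| ≤ Λ * N.indicator (1 : E → ℝ) y) (s : ℝ) (ξ : E) :
    ‖𝓕 (fun y => (g s y : ℂ)) ξ‖ ≤ Λ * volume.real N := by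
  refine (VectorFourier.norm_fourierIntegral_le_integral_norm _ _ _ _ _).trans ?_
  refine le_trans (le_of_eq ?_) (integral_abs_slice_le hg hN hNv hΛ s)
  exact integral_congr_ae (Eventually.of_forall fun y => by
    simp only [Complex.norm_real, Real.norm_eq_abs])

/-- **The Fourier transform of the slices is jointly measurable** in `(s, ξ)` (a parametric
integral of a jointly measurable integrand). [folklore] -/
theorem stronglyMeasurable_fourier_slice (hg : Measurable (uncurry g)) :
    StronglyMeasurable (fun p : ℝ × E => 𝓕 (fun y => (g p.1 y : ℂ)) p.2) := by
  set G : ℝ × E → E → ℂ := fun p y => ((Real.fourierChar (-⟪y, p.2⟫) : ℂ)) * (g p.1 y : ℂ) with hG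
  have hGm : Measurable (uncurry G) := by
    have h1 : Measurable fun q : (ℝ × E) × E => ((Real.fourierChar (-⟪q.2, q.1.2⟫) : ℂ)) :=
      (continuous_subtype_val.comp (Real.continuous_fourierChar.comp
        ((continuous_snd.inner (continuous_snd.comp continuous_fst)).neg))).measurable
    have h2 : Measurable fun q : (ℝ × E) × E => (g q.1.1 q.2 : ℂ) :=
      Complex.measurable_ofReal.comp (hg.comp (measurable_fst.fst.prodMk measurable_snd))
    exact h1.mul h2
  have h := hGm.stronglyMeasurable.integral_prod_right (ν := (volume : Measure E))
  have heq : (fun p : ℝ × E => 𝓕 (fun y => (g p.1 y : ℂ)) p.2) = fun p => ∫ y, G p y := by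
    funext p
    simp only [Real.fourier_eq, Circle.smul_def, smul_eq_mul, hG]
  rw [heq]
  exact h

/-- Measurability of `s ↦ ĝ(s, ξ)` at a fixed frequency. [folklore] -/
theorem measurable_fourier_slice_left (hg : Measurable (uncurry g)) (ξ : E) :
    Measurable (fun s : ℝ => 𝓕 (fun y => (g s y : ℂ)) ξ) :=
  (stronglyMeasurable_fourier_slice hg).measurable.of_uncurry_right

/-- Plancherel for a slice: `∫ |ĝ(s, ·)|² = ∫ |g(s, ·)|²` (`ℝ≥0∞`). [folklore] -/
theorem lintegral_enorm_sq_fourier_slice (hg : Measurable (uncurry g)) (hN : MeasurableSet N)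
    (hNv : volume N < ∞) (hΛ : ∀ s y, |g s y| ≤ Λ * N.indicator (1 : E → ℝ) y) (hΛ0 : 0 ≤ Λ) (s : ℝ) :
    ∫⁻ ξ, ‖𝓕 (fun y => (g s y : ℂ)) ξ‖ₑ ^ 2 = ∫⁻ y, ‖g s y‖ₑ ^ 2 := by
  rw [FunctionSpaces.lintegral_enorm_sq_fourierIntegral_eq (integrable_ofReal_slice hg hN hNv hΛ s)
    (memLp_two_ofReal_slice hg hN hNv hΛ hΛ0 s)]
  exact lintegral_congr fun y => by rw [FunctionSpaces.BMOInv.enorm_ofReal_complex]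

/-- `∫ |g(s, ·)|² ≤ Λ² |N|` (`ℝ≥0∞`). [folklore] -/
theorem lintegral_enorm_sq_slice_le (hN : MeasurableSet N)
    (hΛ : ∀ s y, |g s y| ≤ Λ * N.indicator (1 : E → ℝ) y) (s : ℝ) :
    ∫⁻ y, ‖g s y‖ₑ ^ 2 ≤ ENNReal.ofReal (Λ ^ 2) * volume N := by
  have hpt : ∀ y, ‖g s y‖ₑ ^ 2 ≤ N.indicator (fun _ => ENNReal.ofReal (Λ ^ 2)) y := by
    intro y
    have h := hΛ s y
    by_cases hy : y ∈ N
    · rw [indicator_of_mem hy, Pi.one_apply, mul_one] at h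
      rw [indicator_of_mem hy, ← ofReal_norm, ← ENNReal.ofReal_pow (norm_nonneg _), Real.norm_eq_abs]
      exact ENNReal.ofReal_le_ofReal (pow_le_pow_left₀ (abs_nonneg _) h 2)
    · rw [indicator_of_notMem hy, mul_zero] at h
      have : g s y = 0 := abs_nonpos_iff.1 h
      simp [this]
  calc ∫⁻ y, ‖g s y‖ₑ ^ 2 ≤ ∫⁻ y, N.indicator (fun _ => ENNReal.ofReal (Λ ^ 2)) y := lintegral_mono hpt
    _ = ENNReal.ofReal (Λ ^ 2) * volume N := lintegral_indicator_const hN _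

end Slices

/-! ## The Duhamel term on the Fourier side: `Ŵ(t, ξ) = ∫₀ᵗ e^{-(2π)²(t-s)|ξ|²} ĝ(s, ξ) ds` -/

section FourierSide

variable {g : ℝ → E → ℝ} {Λ : ℝ} {N : Set E}

omit [InnerProductSpace ℝ E] [FiniteDimensional ℝ E] [MeasurableSpace E] [BorelSpace E] in
/-- `(2π)² = 4π²` form of the heat symbol: `exp (-(4π² t ‖ξ‖²)) = heatSymbol t ξ`. [folklore] -/
theorem exp_neg_four_pi_sq_eq_heatSymbol' (t : ℝ) (ξ : E) :
    (Real.exp (-(4 * Real.pi ^ 2 * t * ‖ξ‖ ^ 2)) : ℂ) = (heatSymbol t ξ : ℂ) := by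
  rw [heatSymbol]; congr 2; ring

omit [InnerProductSpace ℝ E] [FiniteDimensional ℝ E] [MeasurableSpace E] [BorelSpace E] in
/-- The heat symbol as the exponential weight of `KochTataruEnergy`:
`e^{-(2π)²(t-s)|ξ|²} = e^{-a(t-s)}` with `a = (2π)²|ξ|²`. [folklore] -/
theorem heatSymbol_sub_eq_exp (t s : ℝ) (ξ : E) :
    heatSymbol (t - s) ξ = Real.exp (-((2 * π) ^ 2 * ‖ξ‖ ^ 2 * (t - s))) := by
  rw [heatSymbol]; congr 1; ring

/-- `s ↦ ĝ(s, ξ)` is integrable on every finite time interval (it is bounded by `Λ|N|`). [folklore] -/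
theorem integrableOn_fourier_slice (hg : Measurable (uncurry g)) (hN : MeasurableSet N)
    (hNv : volume N < ∞) (hΛ : ∀ s y, |g s y| ≤ Λ * N.indicator (1 : E → ℝ) y) (ξ : E) (T : ℝ) :
    IntegrableOn (fun s : ℝ => 𝓕 (fun y => (g s y : ℂ)) ξ) (Ioo 0 T) :=
  Measure.integrableOn_of_bounded (M := Λ * volume.real N) measure_Ioo_lt_top.ne
    (measurable_fourier_slice_left hg ξ).aestronglyMeasurable
    (Eventually.of_forall fun s => norm_fourier_slice_le hg hN hNv hΛ s ξ)

/-- **`Ŵ` is bounded**: `|Ŵ(t, ξ)| ≤ ∫₀ᵀ |ĝ(s, ξ)| ds` for `t ≤ T`. [folklore] -/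
theorem norm_duhamelFourier_le (hg : Measurable (uncurry g)) (hN : MeasurableSet N)
    (hNv : volume N < ∞) (hΛ : ∀ s y, |g s y| ≤ Λ * N.indicator (1 : E → ℝ) y) (ξ : E) {t T : ℝ}
    (htT : t ≤ T) :
    ‖∫ s in Ioo 0 t, (heatSymbol (t - s) ξ : ℂ) * 𝓕 (fun y => (g s y : ℂ)) ξ‖ ≤
      ∫ s in Ioo 0 T, ‖𝓕 (fun y => (g s y : ℂ)) ξ‖ := by
  have h := norm_duhamelExp_le (a := (2 * π) ^ 2 * ‖ξ‖ ^ 2) (h := fun s => 𝓕 (fun y => (g s y : ℂ)) ξ)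
    (by positivity) (integrableOn_fourier_slice hg hN hNv hΛ ξ T) htT
  simpa only [← heatSymbol_sub_eq_exp] using h

/-- `∫₀ᵀ |ĝ(s, ξ)| ds ≤ T Λ |N|` (`T ≥ 0`). [folklore] -/
theorem setIntegral_norm_fourier_slice_le (hg : Measurable (uncurry g)) (hN : MeasurableSet N)
    (hNv : volume N < ∞) (hΛ : ∀ s y, |g s y| ≤ Λ * N.indicator (1 : E → ℝ) y) (ξ : E) {T : ℝ}
    (hT : 0 ≤ T) :
    ∫ s in Ioo 0 T, ‖𝓕 (fun y => (g s y : ℂ)) ξ‖ ≤ T * (Λ * volume.real N) := by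
  have h := norm_setIntegral_le_of_norm_le_const (μ := (volume : Measure ℝ)) (s := Ioo (0 : ℝ) T)
    (C := Λ * volume.real N) (f := fun s : ℝ => ‖𝓕 (fun y => (g s y : ℂ)) ξ‖) measure_Ioo_lt_top
    (fun s _ => by rw [norm_norm]; exact norm_fourier_slice_le hg hN hNv hΛ s ξ)
  rw [Real.norm_of_nonneg (integral_nonneg fun s => norm_nonneg _), Real.volume_real_Ioo_of_le hT,
    sub_zero] at h
  linarith

/-- **`Ŵ` is jointly measurable in `(t, ξ)`.** [folklore] -/
theorem stronglyMeasurable_duhamelFourier (hg : Measurable (uncurry g)) :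
    StronglyMeasurable (fun p : ℝ × E =>
      ∫ s in Ioo 0 p.1, (heatSymbol (p.1 - s) p.2 : ℂ) * 𝓕 (fun y => (g s y : ℂ)) p.2) := by
  set H : ℝ × E → ℝ → ℂ := fun p s =>
    (Ioo 0 p.1).indicator (fun s => (heatSymbol (p.1 - s) p.2 : ℂ) * 𝓕 (fun y => (g s y : ℂ)) p.2) s
    with hH
  have hĝ := (stronglyMeasurable_fourier_slice hg).measurable
  have hHm : Measurable (uncurry H) := by
    have hS : MeasurableSet {q : (ℝ × E) × ℝ | 0 < q.2 ∧ q.2 < q.1.1} :=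
      (measurableSet_lt measurable_const measurable_snd).inter
        (measurableSet_lt measurable_snd measurable_fst.fst)
    have h1 : Measurable fun q : (ℝ × E) × ℝ => (heatSymbol (q.1.1 - q.2) q.1.2 : ℂ) := by
      unfold heatSymbol
      exact Complex.measurable_ofReal.comp (by fun_prop)
    have h2 : Measurable fun q : (ℝ × E) × ℝ => 𝓕 (fun y => (g q.2 y : ℂ)) q.1.2 :=
      hĝ.comp (measurable_snd.prodMk measurable_fst.snd)
    have heq : uncurry H = {q : (ℝ × E) × ℝ | 0 < q.2 ∧ q.2 < q.1.1}.indicator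
        fun q => (heatSymbol (q.1.1 - q.2) q.1.2 : ℂ) * 𝓕 (fun y => (g q.2 y : ℂ)) q.1.2 := by
      funext q
      simp only [uncurry, hH, indicator, mem_Ioo, mem_setOf_eq]
    rw [heq]
    exact (h1.mul h2).indicator hS
  have h := hHm.stronglyMeasurable.integral_prod_right (ν := (volume : Measure ℝ))
  have heq : (fun p : ℝ × E => ∫ s in Ioo 0 p.1, (heatSymbol (p.1 - s) p.2 : ℂ) * 𝓕 (fun y => (g s y : ℂ)) p.2) =
      fun p => ∫ s, H p s := by
    funext p
    rw [hH, integral_indicator measurableSet_Ioo]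
  rw [heq]
  exact h

/-- **The energy inequality for `Ŵ(·, ξ)`** (Koch–Tataru 2001, Remark 3.3 (21), frequency by
frequency; `KochTataruEnergy.mul_setIntegral_norm_sq_duhamelExp_le` with `a = (2π)²|ξ|²`,
`h = ĝ(·, ξ)`): `(2π)²|ξ|² ∫₀ᵀ |Ŵ(t,ξ)|² dt ≤ Re ∫₀ᵀ conj(Ŵ(t,ξ)) ĝ(t,ξ) dt`.
[cite: KochTataruAdvMath2001, Remark 3.3 (21)] -/
theorem energy_duhamelFourier (hg : Measurable (uncurry g)) (hN : MeasurableSet N)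
    (hNv : volume N < ∞) (hΛ : ∀ s y, |g s y| ≤ Λ * N.indicator (1 : E → ℝ) y) (ξ : E) {T : ℝ}
    (hT : 0 < T) :
    (2 * π) ^ 2 * ‖ξ‖ ^ 2 *
        ∫ t in Ioo 0 T, ‖∫ s in Ioo 0 t, (heatSymbol (t - s) ξ : ℂ) * 𝓕 (fun y => (g s y : ℂ)) ξ‖ ^ 2 ≤
      (∫ t in Ioo 0 T, conj (∫ s in Ioo 0 t, (heatSymbol (t - s) ξ : ℂ) * 𝓕 (fun y => (g s y : ℂ)) ξ) *
        𝓕 (fun y => (g t y : ℂ)) ξ).re := by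
  have h := mul_setIntegral_norm_sq_duhamelExp_le (a := (2 * π) ^ 2 * ‖ξ‖ ^ 2)
    (h := fun s => 𝓕 (fun y => (g s y : ℂ)) ξ) (by positivity)
    (measurable_fourier_slice_left hg ξ).aestronglyMeasurable hT (integrableOn_fourier_slice hg hN hNv hΛ ξ T)
  simpa only [← heatSymbol_sub_eq_exp] using h

end FourierSide

/-! ## The heat potential `W(t, x) = ∫₀ᵗ∫ G_{t-s}(x-y) g(s,y) dy ds` and `𝓕W(t) = Ŵ(t)` -/

section Potential

variable {g : ℝ → E → ℝ} {Λ : ℝ} {N : Set E}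

/-- `∫ |g(s, ·)| ≤ Λ |N|` in `ℝ≥0∞`. [folklore] -/
theorem lintegral_enorm_slice_le (hN : MeasurableSet N)
    (hΛ : ∀ s y, |g s y| ≤ Λ * N.indicator (1 : E → ℝ) y) (s : ℝ) :
    ∫⁻ y, ‖g s y‖ₑ ≤ ENNReal.ofReal Λ * volume N := by
  have hpt : ∀ y, ‖g s y‖ₑ ≤ N.indicator (fun _ => ENNReal.ofReal Λ) y := by
    intro y
    have h := hΛ s y
    by_cases hy : y ∈ N
    · rw [indicator_of_mem hy, Pi.one_apply, mul_one] at h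
      rw [indicator_of_mem hy, ← ofReal_norm, Real.norm_eq_abs]
      exact ENNReal.ofReal_le_ofReal h
    · rw [indicator_of_notMem hy, mul_zero] at h
      have : g s y = 0 := abs_nonpos_iff.1 h
      simp [this]
  calc ∫⁻ y, ‖g s y‖ₑ ≤ ∫⁻ y, N.indicator (fun _ => ENNReal.ofReal Λ) y := lintegral_mono hpt
    _ = ENNReal.ofReal Λ * volume N := lintegral_indicator_const hN _

/-- The heat-potential integrand `((s, x), y) ↦ G_{t-s}(x - y) g(s, y)` is jointly measurable.
[folklore] -/
theorem measurable_heatPotentialIntegrand (hg : Measurable (uncurry g)) (t : ℝ) :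
    Measurable (fun q : (ℝ × E) × E => heatKernel (t - q.1.1) (q.1.2 - q.2) * g q.1.1 q.2) := by
  have hK : Measurable fun q : (ℝ × E) × E => heatKernel (t - q.1.1) (q.1.2 - q.2) :=
    measurable_heatKernel_uncurry.comp
      ((measurable_const.sub measurable_fst.fst).prodMk (measurable_fst.snd.sub measurable_snd))
  exact hK.mul (hg.comp (measurable_fst.fst.prodMk measurable_snd))

/-- **The heat-potential integrand is integrable on `(0,t) × E × E`**:
`∫₀ᵗ∫∫ G_{t-s}(x-y) |g(s,y)| dy dx ds = ∫₀ᵗ ‖g(s)‖₁ ds ≤ t Λ |N| < ∞` (`∫ G = 1`). [folklore] -/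
theorem integrable_heatPotentialIntegrand (hg : Measurable (uncurry g)) (hN : MeasurableSet N)
    (hNv : volume N < ∞) (hΛ : ∀ s y, |g s y| ≤ Λ * N.indicator (1 : E → ℝ) y) (t : ℝ) :
    Integrable (fun q : (ℝ × E) × E => heatKernel (t - q.1.1) (q.1.2 - q.2) * g q.1.1 q.2)
      ((((volume : Measure ℝ).restrict (Ioo 0 t)).prod (volume : Measure E)).prod (volume : Measure E)) := by
  set μ : Measure ℝ := (volume : Measure ℝ).restrict (Ioo 0 t) with hμ
  have hm := measurable_heatPotentialIntegrand hg t
  refine ⟨hm.aestronglyMeasurable, ?_⟩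
  rw [hasFiniteIntegral_iff_enorm]
  -- Tonelli: `∫∫∫ |G g| = ∫_s ∫_y |g(s,y)| ∫_x G_{t-s}(x-y) = ∫_s ∫_y |g(s,y)|`
  have h1 : ∫⁻ q, ‖heatKernel (t - q.1.1) (q.1.2 - q.2) * g q.1.1 q.2‖ₑ ∂((μ.prod volume).prod volume) =
      ∫⁻ p, ∫⁻ y, ‖heatKernel (t - p.1) (p.2 - y)‖ₑ * ‖g p.1 y‖ₑ ∂(volume : Measure E) ∂(μ.prod volume) := by
    rw [lintegral_prod _ hm.enorm.aemeasurable]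
    exact lintegral_congr fun p => lintegral_congr fun y => enorm_mul _ _
  have h2 : ∫⁻ p, ∫⁻ y, ‖heatKernel (t - p.1) (p.2 - y)‖ₑ * ‖g p.1 y‖ₑ ∂(volume : Measure E) ∂(μ.prod volume) =
      ∫⁻ s, ∫⁻ x, ∫⁻ y, ‖heatKernel (t - s) (x - y)‖ₑ * ‖g s y‖ₑ ∂(volume : Measure E) ∂(volume : Measure E) ∂μ := by
    refine lintegral_prod _ ?_
    have h' : Measurable fun p : ℝ × E => ∫⁻ y, ‖heatKernel (t - p.1) (p.2 - y) * g p.1 y‖ₑ ∂(volume : Measure E) :=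
      Measurable.lintegral_prod_right' hm.enorm
    have heq : (fun p : ℝ × E => ∫⁻ y, ‖heatKernel (t - p.1) (p.2 - y)‖ₑ * ‖g p.1 y‖ₑ ∂(volume : Measure E)) =
        fun p : ℝ × E => ∫⁻ y, ‖heatKernel (t - p.1) (p.2 - y) * g p.1 y‖ₑ ∂(volume : Measure E) :=
      funext fun p => lintegral_congr fun y => (enorm_mul _ _).symm
    rw [heq]
    exact h'.aemeasurable
  have h3 : ∀ s ∈ Ioo (0 : ℝ) t, ∫⁻ x, ∫⁻ y, ‖heatKernel (t - s) (x - y)‖ₑ * ‖g s y‖ₑ ∂(volume : Measure E)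
      ∂(volume : Measure E) ≤ ENNReal.ofReal Λ * volume N := by
    intro s hs
    have hts : 0 < t - s := sub_pos.2 hs.2
    have hmeas : Measurable fun p : E × E => ‖heatKernel (t - s) (p.1 - p.2)‖ₑ * ‖g s p.2‖ₑ := by
      have ha : Measurable fun p : E × E => heatKernel (t - s) (p.1 - p.2) :=
        (UnboundedOperators.continuous_heatKernel (t - s)).measurable.comp (measurable_fst.sub measurable_snd)
      exact ha.enorm.mul (hg.of_uncurry_left.comp measurable_snd).enorm
    rw [lintegral_lintegral_swap hmeas.aemeasurable]
    calc ∫⁻ y, ∫⁻ x, ‖heatKernel (t - s) (x - y)‖ₑ * ‖g s y‖ₑ ∂(volume : Measure E) ∂(volume : Measure E)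
        = ∫⁻ y, ‖g s y‖ₑ := by
          refine lintegral_congr fun y => ?_
          have hKy : Measurable fun x : E => ‖heatKernel (t - s) (x - y)‖ₑ :=
            ((UnboundedOperators.continuous_heatKernel (t - s)).measurable.comp
              (measurable_id.sub measurable_const)).enorm
          rw [lintegral_mul_const _ hKy, lintegral_sub_right_eq_self (fun x => ‖heatKernel (t - s) x‖ₑ) y,
            UnboundedOperators.lintegral_enorm_heatKernel hts, one_mul]
      _ ≤ ENNReal.ofReal Λ * volume N := lintegral_enorm_slice_le hN hΛ s
  rw [h1, h2]
  calc ∫⁻ s, ∫⁻ x, ∫⁻ y, ‖heatKernel (t - s) (x - y)‖ₑ * ‖g s y‖ₑ ∂(volume : Measure E) ∂(volume : Measure E) ∂μ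
      ≤ ∫⁻ s, ENNReal.ofReal Λ * volume N ∂μ := by
        rw [hμ]
        exact setLIntegral_mono' measurableSet_Ioo h3
    _ = ENNReal.ofReal Λ * volume N * volume (Ioo (0 : ℝ) t) := by
        rw [hμ, lintegral_const, Measure.restrict_apply_univ]
    _ < ∞ := ENNReal.mul_lt_top (ENNReal.mul_lt_top ENNReal.ofReal_lt_top hNv) measure_Ioo_lt_top

/-- The inner integral `(s, x) ↦ ∫ G_{t-s}(x-y) g(s,y) dy` is integrable on `(0,t) × E`. [folklore] -/
theorem integrable_integral_heatPotentialIntegrand (hg : Measurable (uncurry g)) (hN : MeasurableSet N)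
    (hNv : volume N < ∞) (hΛ : ∀ s y, |g s y| ≤ Λ * N.indicator (1 : E → ℝ) y) (t : ℝ) :
    Integrable (fun p : ℝ × E => ∫ y, heatKernel (t - p.1) (p.2 - y) * g p.1 y)
      (((volume : Measure ℝ).restrict (Ioo 0 t)).prod (volume : Measure E)) :=
  (integrable_heatPotentialIntegrand hg hN hNv hΛ t).integral_prod_left

/-- **The heat potential is integrable in `x`** for each `t > 0`:
`W(t, ·) = ∫₀ᵗ (∫ G_{t-s}(·-y) g(s,y) dy) ds ∈ L¹(E)`. [folklore] -/
theorem integrable_heatPotential (hg : Measurable (uncurry g)) (hN : MeasurableSet N)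
    (hNv : volume N < ∞) (hΛ : ∀ s y, |g s y| ≤ Λ * N.indicator (1 : E → ℝ) y) (t : ℝ) :
    Integrable (fun x : E => ∫ s in Ioo 0 t, ∫ y, heatKernel (t - s) (x - y) * g s y) :=
  (integrable_integral_heatPotentialIntegrand hg hN hNv hΛ t).integral_prod_right

/-- The slice `y ↦ G_{t-s}(x - y) g(s, y)` as a convolution: for `s < t`,
`∫ G_{t-s}(x-y) g(s,y) dy = (g(s) ⋆ G_{t-s})(x)`, complexified. [folklore] -/
theorem ofReal_integral_heatKernel_mul_eq_convolution (s t : ℝ) (x : E) :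
    ((∫ y, heatKernel (t - s) (x - y) * g s y : ℝ) : ℂ) =
      ((fun y => (g s y : ℂ)) ⋆[ContinuousLinearMap.mul ℂ ℂ, volume] fun w => (heatKernel (t - s) w : ℂ)) x := by
  rw [convolution_def, ← integral_complex_ofReal]
  congr 1
  funext y
  simp only [ContinuousLinearMap.mul_apply', Complex.ofReal_mul]
  ring

/-- **The Fourier transform of the heat potential is the Duhamel term of the transformed
slices**: for `t > 0`, `𝓕(W(t, ·))(ξ) = ∫₀ᵗ e^{-(2π)²(t-s)|ξ|²} ĝ(s, ξ) ds` (Fubini in `(x, s)`,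
the convolution theorem and `𝓕G_τ = e^{-(2π)²τ|ξ|²}`). [folklore] -/
theorem fourier_heatPotential (hg : Measurable (uncurry g)) (hN : MeasurableSet N)
    (hNv : volume N < ∞) (hΛ : ∀ s y, |g s y| ≤ Λ * N.indicator (1 : E → ℝ) y) (t : ℝ) (ξ : E) :
    𝓕 (fun x : E => ((∫ s in Ioo 0 t, ∫ y, heatKernel (t - s) (x - y) * g s y : ℝ) : ℂ)) ξ =
      ∫ s in Ioo 0 t, (heatSymbol (t - s) ξ : ℂ) * 𝓕 (fun y => (g s y : ℂ)) ξ := by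
  set μ : Measure ℝ := (volume : Measure ℝ).restrict (Ioo 0 t) with hμ
  have hF := integrable_integral_heatPotentialIntegrand hg hN hNv hΛ t
  -- the integrand `(x, s) ↦ 𝐞(-⟪x,ξ⟫) F(s, x)` on `E × (0,t)`
  have hsw : Integrable (fun p : E × ℝ => ((Real.fourierChar (-⟪p.1, ξ⟫) : ℂ)) *
      ((∫ y, heatKernel (t - p.2) (p.1 - y) * g p.2 y : ℝ) : ℂ)) (volume.prod μ) := by
    have h1 : Integrable (fun p : E × ℝ => ((∫ y, heatKernel (t - p.2) (p.1 - y) * g p.2 y : ℝ) : ℂ))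
        (volume.prod μ) := hF.swap.ofReal
    refine h1.norm.mono' ?_ (Eventually.of_forall fun p => ?_)
    · have hc : Continuous fun p : E × ℝ => -⟪p.1, ξ⟫ := (continuous_fst.inner continuous_const).neg
      exact (continuous_subtype_val.comp (Real.continuous_fourierChar.comp hc)).aestronglyMeasurable.mul
        h1.aestronglyMeasurable
    · rw [norm_mul, Circle.norm_coe, one_mul]
  simp only [Real.fourier_eq, Circle.smul_def, smul_eq_mul]
  calc ∫ x : E, ((Real.fourierChar (-⟪x, ξ⟫) : ℂ)) * ((∫ s in Ioo 0 t, ∫ y, heatKernel (t - s) (x - y) * g s y : ℝ) : ℂ)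
      = ∫ x : E, ∫ s in Ioo 0 t, ((Real.fourierChar (-⟪x, ξ⟫) : ℂ)) *
          ((∫ y, heatKernel (t - s) (x - y) * g s y : ℝ) : ℂ) := by
        refine integral_congr_ae (Eventually.of_forall fun x => ?_)
        dsimp only
        rw [← integral_complex_ofReal, ← integral_const_mul]
    _ = ∫ s in Ioo 0 t, ∫ x : E, ((Real.fourierChar (-⟪x, ξ⟫) : ℂ)) *
          ((∫ y, heatKernel (t - s) (x - y) * g s y : ℝ) : ℂ) := integral_integral_swap hsw
    _ = ∫ s in Ioo 0 t, (heatSymbol (t - s) ξ : ℂ) * ∫ y : E, ((Real.fourierChar (-⟪y, ξ⟫) : ℂ)) * (g s y : ℂ) := by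
        refine setIntegral_congr_fun measurableSet_Ioo fun s hs => ?_
        have hts : 0 < t - s := sub_pos.2 hs.2
        have hG : Integrable (fun w : E => (heatKernel (t - s) w : ℂ)) :=
          (UnboundedOperators.integrable_heatKernel_holds hts).ofReal
        have hgs : Integrable (fun y => (g s y : ℂ)) := integrable_ofReal_slice hg hN hNv hΛ s
        have hconv := Real.fourier_mul_convolution_eq hgs hG ξ
        simp only [Real.fourier_eq, Circle.smul_def, smul_eq_mul] at hconv
        simp_rw [ofReal_integral_heatKernel_mul_eq_convolution]
        rw [hconv]
        have hK : 𝓕 (fun w : E => (heatKernel (t - s) w : ℂ)) ξ =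
            (Real.exp (-(4 * Real.pi ^ 2 * (t - s) * ‖ξ‖ ^ 2)) : ℂ) :=
          FunctionSpaces.BMOInv.fourier_ofReal_heatKernel (E := E) hts ξ
        simp only [Real.fourier_eq, Circle.smul_def, smul_eq_mul] at hK
        rw [hK, exp_neg_four_pi_sq_eq_heatSymbol' (t - s) ξ, mul_comm]

end Potential

/-! ## Integrating the energy inequality over frequencies -/

section FrequencyIntegral

variable {g : ℝ → E → ℝ} {Λ : ℝ} {N : Set E}

/-- `L²` size of the transformed slices: `(∫ |ĝ(s,·)|²)^{1/2} ≤ (Λ²|N|)^{1/2}`. [folklore] -/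
theorem lintegral_enorm_sq_fourier_slice_rpow_le (hg : Measurable (uncurry g)) (hN : MeasurableSet N)
    (hNv : volume N < ∞) (hΛ : ∀ s y, |g s y| ≤ Λ * N.indicator (1 : E → ℝ) y) (hΛ0 : 0 ≤ Λ) (s : ℝ) :
    (∫⁻ ξ, ‖𝓕 (fun y => (g s y : ℂ)) ξ‖ₑ ^ (2 : ℝ)) ^ (1 / 2 : ℝ) ≤
      (ENNReal.ofReal (Λ ^ 2) * volume N) ^ (1 / 2 : ℝ) := by
  refine ENNReal.rpow_le_rpow ?_ (by norm_num)
  have h := lintegral_enorm_sq_fourier_slice hg hN hNv hΛ hΛ0 s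
  have h2 : ∫⁻ ξ, ‖𝓕 (fun y => (g s y : ℂ)) ξ‖ₑ ^ (2 : ℝ) = ∫⁻ ξ, ‖𝓕 (fun y => (g s y : ℂ)) ξ‖ₑ ^ 2 :=
    lintegral_congr fun ξ => by rw [← ENNReal.rpow_natCast]; norm_num
  rw [h2, h]
  exact lintegral_enorm_sq_slice_le hN hΛ s

/-- **Cauchy–Schwarz across frequencies**: `∫ |ĝ(s,ξ)| |ĝ(t,ξ)| dξ ≤ Λ² |N|`. [folklore] -/
theorem lintegral_enorm_fourier_slice_mul_le (hg : Measurable (uncurry g)) (hN : MeasurableSet N)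
    (hNv : volume N < ∞) (hΛ : ∀ s y, |g s y| ≤ Λ * N.indicator (1 : E → ℝ) y) (hΛ0 : 0 ≤ Λ) (s t : ℝ) :
    ∫⁻ ξ, ‖𝓕 (fun y => (g s y : ℂ)) ξ‖ₑ * ‖𝓕 (fun y => (g t y : ℂ)) ξ‖ₑ ≤
      ENNReal.ofReal (Λ ^ 2) * volume N := by
  have hm : ∀ r : ℝ, AEMeasurable (fun ξ : E => ‖𝓕 (fun y => (g r y : ℂ)) ξ‖ₑ) volume := fun r =>
    (FunctionSpaces.continuous_fourierIntegral (integrable_ofReal_slice hg hN hNv hΛ r)).measurable.enorm.aemeasurable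
  have h := ENNReal.lintegral_mul_le_Lp_mul_Lq (volume : Measure E) Real.HolderConjugate.two_two (hm s) (hm t)
  simp only [Pi.mul_apply] at h
  refine h.trans ?_
  calc (∫⁻ ξ, ‖𝓕 (fun y => (g s y : ℂ)) ξ‖ₑ ^ (2 : ℝ)) ^ (1 / 2 : ℝ) *
        (∫⁻ ξ, ‖𝓕 (fun y => (g t y : ℂ)) ξ‖ₑ ^ (2 : ℝ)) ^ (1 / 2 : ℝ)
      ≤ (ENNReal.ofReal (Λ ^ 2) * volume N) ^ (1 / 2 : ℝ) * (ENNReal.ofReal (Λ ^ 2) * volume N) ^ (1 / 2 : ℝ) :=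
        mul_le_mul' (lintegral_enorm_sq_fourier_slice_rpow_le hg hN hNv hΛ hΛ0 s)
          (lintegral_enorm_sq_fourier_slice_rpow_le hg hN hNv hΛ hΛ0 t)
    _ = ENNReal.ofReal (Λ ^ 2) * volume N := by
        rw [← ENNReal.rpow_add_of_nonneg _ _ (by norm_num) (by norm_num)]
        norm_num

/-- **The integrand `conj(Ŵ(t,ξ)) ĝ(t,ξ)` is integrable on `(0,T) × E_ξ`**: its modulus is at
most `(∫₀ᵀ |ĝ(s,ξ)| ds) |ĝ(t,ξ)|`, whose integral is `≤ T² Λ² |N|` by Tonelli and Cauchy–Schwarz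
across frequencies (Plancherel for the slices). This is what allows the order of the `t`- and
`ξ`-integrations to be exchanged in Remark 3.3. [folklore] -/
theorem integrable_conj_duhamelFourier_mul (hg : Measurable (uncurry g)) (hN : MeasurableSet N)
    (hNv : volume N < ∞) (hΛ : ∀ s y, |g s y| ≤ Λ * N.indicator (1 : E → ℝ) y) (hΛ0 : 0 ≤ Λ) (T : ℝ) :
    Integrable (fun p : ℝ × E =>
      conj (∫ s in Ioo 0 p.1, (heatSymbol (p.1 - s) p.2 : ℂ) * 𝓕 (fun y => (g s y : ℂ)) p.2) *
        𝓕 (fun y => (g p.1 y : ℂ)) p.2)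
      (((volume : Measure ℝ).restrict (Ioo 0 T)).prod (volume : Measure E)) := by
  set μ : Measure ℝ := (volume : Measure ℝ).restrict (Ioo 0 T) with hμ
  have hĝm := (stronglyMeasurable_fourier_slice hg).measurable
  have hWm := (stronglyMeasurable_duhamelFourier hg).measurable
  -- the dominating function
  set Φ : ℝ × E → ℝ := fun p => (∫ s in Ioo 0 T, ‖𝓕 (fun y => (g s y : ℂ)) p.2‖) * ‖𝓕 (fun y => (g p.1 y : ℂ)) p.2‖
    with hΦ
  -- measurability of `ξ ↦ ∫₀ᵀ |ĝ(s,ξ)| ds`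
  have hIm : Measurable fun ξ : E => ∫ s in Ioo 0 T, ‖𝓕 (fun y => (g s y : ℂ)) ξ‖ := by
    have h1 : StronglyMeasurable (uncurry fun (ξ : E) (s : ℝ) =>
        (Ioo 0 T).indicator (fun s => ‖𝓕 (fun y => (g s y : ℂ)) ξ‖) s) := by
      have h2 : Measurable fun q : E × ℝ => ‖𝓕 (fun y => (g q.2 y : ℂ)) q.1‖ :=
        (hĝm.comp (measurable_snd.prodMk measurable_fst)).norm
      have heq : (uncurry fun (ξ : E) (s : ℝ) => (Ioo 0 T).indicator (fun s => ‖𝓕 (fun y => (g s y : ℂ)) ξ‖) s) =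
          (Prod.snd ⁻¹' Ioo 0 T).indicator fun q : E × ℝ => ‖𝓕 (fun y => (g q.2 y : ℂ)) q.1‖ := by
        funext q; simp only [uncurry, indicator, mem_preimage]
      rw [heq]
      exact (h2.indicator (measurable_snd measurableSet_Ioo)).stronglyMeasurable
    have h3 := h1.integral_prod_right (ν := (volume : Measure ℝ))
    have heq : (fun ξ : E => ∫ s in Ioo 0 T, ‖𝓕 (fun y => (g s y : ℂ)) ξ‖) =
        fun ξ => ∫ s, (Ioo 0 T).indicator (fun s => ‖𝓕 (fun y => (g s y : ℂ)) ξ‖) s := by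
      funext ξ; rw [integral_indicator measurableSet_Ioo]
    rw [heq]
    exact h3.measurable
  have hΦm : AEStronglyMeasurable Φ (μ.prod volume) :=
    ((hIm.comp measurable_snd).mul (hĝm.norm)).aestronglyMeasurable
  -- finiteness of `∫ Φ`
  have hΦi : Integrable Φ (μ.prod volume) := by
    refine ⟨hΦm, ?_⟩
    rw [hasFiniteIntegral_iff_enorm]
    have hnn : ∀ p, 0 ≤ Φ p := fun p => mul_nonneg (integral_nonneg fun s => norm_nonneg _) (norm_nonneg _)
    have hΦe : ∀ p : ℝ × E, ‖Φ p‖ₑ = (∫⁻ s in Ioo 0 T, ‖𝓕 (fun y => (g s y : ℂ)) p.2‖ₑ) *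
        ‖𝓕 (fun y => (g p.1 y : ℂ)) p.2‖ₑ := by
      intro p
      rw [Real.enorm_eq_ofReal (hnn p), hΦ]
      dsimp only
      rw [ENNReal.ofReal_mul (integral_nonneg fun s => norm_nonneg _), ofReal_norm,
        ofReal_integral_eq_lintegral_ofReal (integrableOn_fourier_slice hg hN hNv hΛ p.2 T).norm
          (Eventually.of_forall fun s => norm_nonneg _)]
      congr 1
      exact lintegral_congr fun s => ofReal_norm _
    simp_rw [hΦe]
    have hmeas2 : Measurable fun p : ℝ × E => (∫⁻ s in Ioo 0 T, ‖𝓕 (fun y => (g s y : ℂ)) p.2‖ₑ) *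
        ‖𝓕 (fun y => (g p.1 y : ℂ)) p.2‖ₑ := by
      have h1 : Measurable fun ξ : E => ∫⁻ s in Ioo 0 T, ‖𝓕 (fun y => (g s y : ℂ)) ξ‖ₑ :=
        (hĝm.comp (measurable_snd.prodMk measurable_fst)).enorm.lintegral_prod_right'
      exact (h1.comp measurable_snd).mul hĝm.enorm
    rw [lintegral_prod _ hmeas2.aemeasurable]
    -- inner integral in `ξ` for fixed `t`: Tonelli and Cauchy–Schwarz
    have hinner : ∀ t : ℝ, ∫⁻ ξ, (∫⁻ s in Ioo 0 T, ‖𝓕 (fun y => (g s y : ℂ)) ξ‖ₑ) *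
        ‖𝓕 (fun y => (g t y : ℂ)) ξ‖ₑ ∂(volume : Measure E) ≤
        ENNReal.ofReal (Λ ^ 2) * volume N * volume (Ioo (0 : ℝ) T) := by
      intro t
      have hmt : Measurable fun ξ : E => 𝓕 (fun y => (g t y : ℂ)) ξ :=
        (FunctionSpaces.continuous_fourierIntegral (integrable_ofReal_slice hg hN hNv hΛ t)).measurable
      have hm3 : Measurable fun q : E × ℝ => ‖𝓕 (fun y => (g q.2 y : ℂ)) q.1‖ₑ * ‖𝓕 (fun y => (g t y : ℂ)) q.1‖ₑ :=
        (hĝm.comp (measurable_snd.prodMk measurable_fst)).enorm.mul (hmt.comp measurable_fst).enorm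
      calc ∫⁻ ξ, (∫⁻ s in Ioo 0 T, ‖𝓕 (fun y => (g s y : ℂ)) ξ‖ₑ) * ‖𝓕 (fun y => (g t y : ℂ)) ξ‖ₑ ∂(volume : Measure E)
          = ∫⁻ ξ : E, ∫⁻ s in Ioo 0 T, ‖𝓕 (fun y => (g s y : ℂ)) ξ‖ₑ * ‖𝓕 (fun y => (g t y : ℂ)) ξ‖ₑ := by
            refine lintegral_congr fun ξ => ?_
            have hmξ : Measurable fun s : ℝ => ‖𝓕 (fun y => (g s y : ℂ)) ξ‖ₑ := (measurable_fourier_slice_left hg ξ).enorm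
            rw [lintegral_mul_const _ hmξ]
        _ = ∫⁻ s in Ioo 0 T, ∫⁻ ξ : E, ‖𝓕 (fun y => (g s y : ℂ)) ξ‖ₑ * ‖𝓕 (fun y => (g t y : ℂ)) ξ‖ₑ :=
            lintegral_lintegral_swap hm3.aemeasurable
        _ ≤ ∫⁻ s in Ioo 0 T, ENNReal.ofReal (Λ ^ 2) * volume N :=
            lintegral_mono fun s => lintegral_enorm_fourier_slice_mul_le hg hN hNv hΛ hΛ0 s t
        _ = ENNReal.ofReal (Λ ^ 2) * volume N * volume (Ioo (0 : ℝ) T) := setLIntegral_const _ _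
    calc ∫⁻ t, ∫⁻ ξ, (∫⁻ s in Ioo 0 T, ‖𝓕 (fun y => (g s y : ℂ)) ξ‖ₑ) * ‖𝓕 (fun y => (g t y : ℂ)) ξ‖ₑ
          ∂(volume : Measure E) ∂μ
        ≤ ∫⁻ t, ENNReal.ofReal (Λ ^ 2) * volume N * volume (Ioo (0 : ℝ) T) ∂μ := lintegral_mono fun t => hinner t
      _ = ENNReal.ofReal (Λ ^ 2) * volume N * volume (Ioo (0 : ℝ) T) * volume (Ioo (0 : ℝ) T) := by
          rw [lintegral_const, hμ, Measure.restrict_apply_univ]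
      _ < ∞ := by
          refine ENNReal.mul_lt_top (ENNReal.mul_lt_top (ENNReal.mul_lt_top ENNReal.ofReal_lt_top hNv)
            measure_Ioo_lt_top) measure_Ioo_lt_top
  -- domination, a.e. on `(0,T) × E`
  refine hΦi.mono' ((Complex.continuous_conj.measurable.comp hWm).mul hĝm).aestronglyMeasurable ?_
  have hprod : μ.prod (volume : Measure E) =
      ((volume : Measure ℝ).prod (volume : Measure E)).restrict (Ioo 0 T ×ˢ univ) := by
    rw [hμ, ← Measure.prod_restrict, Measure.restrict_univ]
  rw [hprod, ae_restrict_iff' (measurableSet_Ioo.prod MeasurableSet.univ)]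
  refine Eventually.of_forall fun p hp => ?_
  rw [mem_prod] at hp
  rw [norm_mul, RCLike.norm_conj, hΦ]
  exact mul_le_mul_of_nonneg_right (norm_duhamelFourier_le hg hN hNv hΛ p.2 hp.1.2.le) (norm_nonneg _)

end FrequencyIntegral

/-! ## Parseval on each time slice and the integrated energy inequality -/

section Parseval

variable {g : ℝ → E → ℝ} {Λ : ℝ} {N : Set E}

/-- **Parseval on a time slice** (the step `∫ conj(𝓕Vg) 𝓕g dξ = ∫ (Vg) g dx` of Koch–Tataru's
Remark 3.3): for every `t`, if the heat potential `W(t, ·)` is bounded then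
`Re ∫ conj(Ŵ(t,ξ)) ĝ(t,ξ) dξ = ∫ W(t,x) g(t,x) dx`. [cite: KochTataruAdvMath2001, Remark 3.3] -/
theorem re_integral_conj_duhamelFourier_mul_eq (hg : Measurable (uncurry g)) (hN : MeasurableSet N)
    (hNv : volume N < ∞) (hΛ : ∀ s y, |g s y| ≤ Λ * N.indicator (1 : E → ℝ) y) (hΛ0 : 0 ≤ Λ) (t : ℝ)
    {P : ℝ} (hWb : ∀ x, |∫ s in Ioo 0 t, ∫ y, heatKernel (t - s) (x - y) * g s y| ≤ P) :
    (∫ ξ, conj (∫ s in Ioo 0 t, (heatSymbol (t - s) ξ : ℂ) * 𝓕 (fun y => (g s y : ℂ)) ξ) *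
        𝓕 (fun y => (g t y : ℂ)) ξ).re =
      ∫ x, (∫ s in Ioo 0 t, ∫ y, heatKernel (t - s) (x - y) * g s y) * g t x := by
  set f : E → ℂ := fun x => ((∫ s in Ioo 0 t, ∫ y, heatKernel (t - s) (x - y) * g s y : ℝ) : ℂ) with hf
  have hf1 : Integrable f := (integrable_heatPotential hg hN hNv hΛ t).ofReal
  have hf2 : MemLp f 2 volume := memLp_two_of_integrable_of_bound hf1 (M := P) fun x => by
    rw [hf, Complex.norm_real, Real.norm_eq_abs]; exact hWb x
  have hg1 : Integrable (fun y => (g t y : ℂ)) := integrable_ofReal_slice hg hN hNv hΛ t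
  have hg2 : MemLp (fun y => (g t y : ℂ)) 2 volume := memLp_two_ofReal_slice hg hN hNv hΛ hΛ0 t
  have hF : 𝓕 f = fun ξ => ∫ s in Ioo 0 t, (heatSymbol (t - s) ξ : ℂ) * 𝓕 (fun y => (g s y : ℂ)) ξ :=
    funext fun ξ => fourier_heatPotential hg hN hNv hΛ t ξ
  have h := re_integral_conj_fourier_mul_eq hf1 hf2 hg1 hg2
  rw [hF] at h
  simp only at h
  rw [h]
  have h2 : (∫ x, conj (f x) * (g t x : ℂ)) =
      ((∫ x, (∫ s in Ioo 0 t, ∫ y, heatKernel (t - s) (x - y) * g s y) * g t x : ℝ) : ℂ) := by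
    rw [← integral_complex_ofReal]
    congr 1
    funext x
    simp only [hf, Complex.conj_ofReal, Complex.ofReal_mul]
  rw [h2, Complex.ofReal_re]

/-- `∫ W(t,x) g(t,x) dx ≤ P ∫ |g(t, ·)|` when `|W(t, ·)| ≤ P`. [folklore] -/
theorem integral_heatPotential_mul_le (hg : Measurable (uncurry g)) (hN : MeasurableSet N)
    (hNv : volume N < ∞) (hΛ : ∀ s y, |g s y| ≤ Λ * N.indicator (1 : E → ℝ) y) (t : ℝ)
    {P : ℝ} (hWb : ∀ x, |∫ s in Ioo 0 t, ∫ y, heatKernel (t - s) (x - y) * g s y| ≤ P) :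
    ∫ x, (∫ s in Ioo 0 t, ∫ y, heatKernel (t - s) (x - y) * g s y) * g t x ≤ P * ∫ x, |g t x| := by
  have hgi := integrable_slice hg hN hNv hΛ t
  have hWm := (integrable_heatPotential hg hN hNv hΛ t).aestronglyMeasurable
  have hdom : Integrable (fun x => P * |g t x|) := hgi.abs.const_mul P
  have hpt : ∀ x, (∫ s in Ioo 0 t, ∫ y, heatKernel (t - s) (x - y) * g s y) * g t x ≤ P * |g t x| := by
    intro x
    calc (∫ s in Ioo 0 t, ∫ y, heatKernel (t - s) (x - y) * g s y) * g t x
        ≤ |(∫ s in Ioo 0 t, ∫ y, heatKernel (t - s) (x - y) * g s y) * g t x| := le_abs_self _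
      _ = |∫ s in Ioo 0 t, ∫ y, heatKernel (t - s) (x - y) * g s y| * |g t x| := abs_mul _ _
      _ ≤ P * |g t x| := mul_le_mul_of_nonneg_right (hWb x) (abs_nonneg _)
  have hprod : Integrable (fun x => (∫ s in Ioo 0 t, ∫ y, heatKernel (t - s) (x - y) * g s y) * g t x) := by
    refine hdom.mono' (hWm.mul hgi.aestronglyMeasurable) (Eventually.of_forall fun x => ?_)
    rw [Real.norm_eq_abs, abs_mul]
    exact mul_le_mul_of_nonneg_right (hWb x) (abs_nonneg _)
  rw [← integral_const_mul]
  exact integral_mono hprod hdom hpt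

end Parseval

/-! ## The integrated energy inequality: `∫ (2π)²|ξ|² ∫₀ᵀ |Ŵ|² dt dξ ≤ ‖Vg‖_∞ ‖g‖_{L¹}` -/

section Integrated

variable {g : ℝ → E → ℝ} {Λ : ℝ} {N : Set E}

/-- `t ↦ ∫ |g(t, ·)|` is measurable. [folklore] -/
theorem measurable_integral_abs_slice (hg : Measurable (uncurry g)) :
    Measurable (fun t : ℝ => ∫ x, |g t x|) := by
  have h : StronglyMeasurable (uncurry fun (t : ℝ) (x : E) => |g t x|) := hg.stronglyMeasurable.norm
  exact (h.integral_prod_right (ν := (volume : Measure E))).measurable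

/-- **The integrated energy inequality** (Koch–Tataru 2001, Remark 3.3: (21) integrated in
frequency and Parseval, `∫₀ᵀ ‖∇Vg‖²₂ ≤ ∫₀ᵀ∫ (Vg) g ≤ ‖Vg‖_∞ ‖g‖_{L¹}`), for a jointly measurable scalar
source `g` with `|g(s,y)| ≤ Λ 1_N(y)` (`|N| < ∞`) whose heat potential `W = Vg` is bounded by `P` on
`(0,T) × E`:
`∫ (2π)²|ξ|² (∫₀ᵀ |Ŵ(t,ξ)|² dt) dξ ≤ P ∫₀ᵀ ∫ |g(t,x)| dx dt` in `ℝ≥0∞`, where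
`Ŵ(t,ξ) = ∫₀ᵗ e^{-(2π)²(t-s)|ξ|²} ĝ(s,ξ) ds = 𝓕(W(t,·))(ξ)` (`fourier_heatPotential`). Proof: the
frequency-wise energy inequality (`energy_duhamelFourier`), Fubini in `(t, ξ)`
(`integrable_conj_duhamelFourier_mul`), Parseval on each slice
(`re_integral_conj_duhamelFourier_mul_eq`) and `∫ W g ≤ P ∫|g|`. [cite: KochTataruAdvMath2001, Remark 3.3 (21)] -/
theorem lintegral_freq_energy_duhamelFourier_le (hg : Measurable (uncurry g)) (hN : MeasurableSet N)
    (hNv : volume N < ∞) (hΛ : ∀ s y, |g s y| ≤ Λ * N.indicator (1 : E → ℝ) y) (hΛ0 : 0 ≤ Λ) {T : ℝ}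
    (hT : 0 < T) {P : ℝ} (hP0 : 0 ≤ P)
    (hWb : ∀ t ∈ Ioo (0 : ℝ) T, ∀ x, |∫ s in Ioo 0 t, ∫ y, heatKernel (t - s) (x - y) * g s y| ≤ P) :
    ∫⁻ ξ, ENNReal.ofReal ((2 * π) ^ 2 * ‖ξ‖ ^ 2) *
        ∫⁻ t in Ioo 0 T, ‖∫ s in Ioo 0 t, (heatSymbol (t - s) ξ : ℂ) * 𝓕 (fun y => (g s y : ℂ)) ξ‖ₑ ^ 2 ≤
      ENNReal.ofReal P * ∫⁻ t in Ioo 0 T, ∫⁻ x, ‖g t x‖ₑ := by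
  set μ : Measure ℝ := (volume : Measure ℝ).restrict (Ioo 0 T) with hμ
  -- notation
  set Ŵ : ℝ → E → ℂ := fun t ξ => ∫ s in Ioo 0 t, (heatSymbol (t - s) ξ : ℂ) * 𝓕 (fun y => (g s y : ℂ)) ξ with hŴ
  set F : ℝ × E → ℂ := fun p => conj (Ŵ p.1 p.2) * 𝓕 (fun y => (g p.1 y : ℂ)) p.2 with hF
  have hFi : Integrable F (μ.prod volume) := integrable_conj_duhamelFourier_mul hg hN hNv hΛ hΛ0 T
  set R : E → ℝ := fun ξ => (∫ t, F (t, ξ) ∂μ).re with hR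
  have hŴm := (stronglyMeasurable_duhamelFourier hg).measurable
  have hbound : ∀ ξ, ∀ t ∈ Ioo (0 : ℝ) T, ‖Ŵ t ξ‖ ≤ T * (Λ * volume.real N) := fun ξ t ht =>
    (norm_duhamelFourier_le hg hN hNv hΛ ξ ht.2.le).trans (setIntegral_norm_fourier_slice_le hg hN hNv hΛ ξ hT.le)
  -- Step 1: pointwise in `ξ`
  have hstep1 : ∀ ξ : E, ENNReal.ofReal ((2 * π) ^ 2 * ‖ξ‖ ^ 2) * ∫⁻ t in Ioo 0 T, ‖Ŵ t ξ‖ₑ ^ 2 ≤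
      ENNReal.ofReal (R ξ) := by
    intro ξ
    have hmξ : Measurable fun t => Ŵ t ξ := hŴm.of_uncurry_right
    have hint : IntegrableOn (fun t => ‖Ŵ t ξ‖ ^ 2) (Ioo 0 T) := by
      refine Measure.integrableOn_of_bounded (M := (T * (Λ * volume.real N)) ^ 2) measure_Ioo_lt_top.ne
        (hmξ.norm.pow_const 2).aestronglyMeasurable ?_
      rw [ae_restrict_iff' measurableSet_Ioo]
      refine Eventually.of_forall fun t ht => ?_
      rw [Real.norm_of_nonneg (sq_nonneg _)]
      exact pow_le_pow_left₀ (norm_nonneg _) (hbound ξ t ht) 2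
    have h1 : ∫⁻ t in Ioo 0 T, ‖Ŵ t ξ‖ₑ ^ 2 = ENNReal.ofReal (∫ t in Ioo 0 T, ‖Ŵ t ξ‖ ^ 2) := by
      rw [ofReal_integral_eq_lintegral_ofReal hint (Eventually.of_forall fun t => sq_nonneg _)]
      exact lintegral_congr fun t => by rw [← ofReal_norm, ENNReal.ofReal_pow (norm_nonneg _)]
    rw [h1, ← ENNReal.ofReal_mul (by positivity)]
    refine ENNReal.ofReal_le_ofReal ?_
    have h2 := energy_duhamelFourier hg hN hNv hΛ ξ hT
    exact h2
  -- Step 2: `R` is nonnegative and integrable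
  have hR0 : ∀ ξ, 0 ≤ R ξ := by
    intro ξ
    have h2 := energy_duhamelFourier hg hN hNv hΛ ξ hT
    refine le_trans ?_ h2
    exact mul_nonneg (by positivity) (integral_nonneg fun t => sq_nonneg _)
  have hRi : Integrable R := (hFi.integral_prod_right).re
  have hstep2 : ∫⁻ ξ, ENNReal.ofReal (R ξ) = ENNReal.ofReal (∫ ξ, R ξ) :=
    (ofReal_integral_eq_lintegral_ofReal hRi (Eventually.of_forall hR0)).symm
  -- Step 3: Fubini and Parseval
  have hstep3 : ∫ ξ, R ξ ≤ P * ∫ t in Ioo 0 T, ∫ x, |g t x| := by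
    have h1 : ∫ ξ, R ξ = (∫ t, ∫ ξ, F (t, ξ) ∂(volume : Measure E) ∂μ).re := by
      have h1a := integral_re hFi.integral_prod_right
      simp only [RCLike.re_to_complex] at h1a
      rw [hR]
      dsimp only
      rw [h1a]
      congr 1
      exact integral_integral_swap hFi.swap
    have h2 : (∫ t, ∫ ξ, F (t, ξ) ∂(volume : Measure E) ∂μ).re = ∫ t, (∫ ξ, F (t, ξ) ∂(volume : Measure E)).re ∂μ := by
      have h2a := integral_re hFi.integral_prod_left
      simp only [RCLike.re_to_complex] at h2a
      exact h2a.symm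
    have h3 : ∀ t ∈ Ioo (0 : ℝ) T, (∫ ξ, F (t, ξ) ∂(volume : Measure E)).re ≤ P * ∫ x, |g t x| := by
      intro t ht
      rw [hF]
      dsimp only
      rw [re_integral_conj_duhamelFourier_mul_eq hg hN hNv hΛ hΛ0 t (hWb t ht)]
      exact integral_heatPotential_mul_le hg hN hNv hΛ t (hWb t ht)
    have h4i : Integrable (fun t => P * ∫ x, |g t x|) μ := by
      refine Measure.integrableOn_of_bounded (M := P * (Λ * volume.real N)) measure_Ioo_lt_top.ne
        ((measurable_integral_abs_slice hg).const_mul P).aestronglyMeasurable ?_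
      refine Eventually.of_forall fun t => ?_
      rw [Real.norm_of_nonneg (mul_nonneg hP0 (integral_nonneg fun x => abs_nonneg _))]
      exact mul_le_mul_of_nonneg_left (integral_abs_slice_le hg hN hNv hΛ t) hP0
    rw [h1, h2]
    calc ∫ t, (∫ ξ, F (t, ξ) ∂(volume : Measure E)).re ∂μ ≤ ∫ t, P * (∫ x, |g t x|) ∂μ := by
          rw [hμ]
          exact setIntegral_mono_on (hFi.integral_prod_left).re h4i measurableSet_Ioo h3
      _ = P * ∫ t in Ioo 0 T, ∫ x, |g t x| := integral_const_mul _ _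
  -- Step 4: back to `ℝ≥0∞`
  have hstep4 : ENNReal.ofReal (P * ∫ t in Ioo 0 T, ∫ x, |g t x|) =
      ENNReal.ofReal P * ∫⁻ t in Ioo 0 T, ∫⁻ x, ‖g t x‖ₑ := by
    have hgi : IntegrableOn (fun t => ∫ x, |g t x|) (Ioo 0 T) :=
      Measure.integrableOn_of_bounded (M := Λ * volume.real N) measure_Ioo_lt_top.ne
        (measurable_integral_abs_slice hg).aestronglyMeasurable
        (Eventually.of_forall fun t => by
          rw [Real.norm_of_nonneg (integral_nonneg fun x => abs_nonneg _)]
          exact integral_abs_slice_le hg hN hNv hΛ t)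
    rw [ENNReal.ofReal_mul hP0, ofReal_integral_eq_lintegral_ofReal hgi
      (Eventually.of_forall fun t => integral_nonneg fun x => abs_nonneg _)]
    congr 1
    refine lintegral_congr fun t => ?_
    rw [show (fun x => |g t x|) = fun x => ‖g t x‖ from funext fun x => (Real.norm_eq_abs _).symm,
      ofReal_integral_norm_eq_lintegral_enorm (integrable_slice hg hN hNv hΛ t)]
  calc ∫⁻ ξ, ENNReal.ofReal ((2 * π) ^ 2 * ‖ξ‖ ^ 2) * ∫⁻ t in Ioo 0 T, ‖Ŵ t ξ‖ₑ ^ 2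
      ≤ ∫⁻ ξ, ENNReal.ofReal (R ξ) := lintegral_mono hstep1
    _ = ENNReal.ofReal (∫ ξ, R ξ) := hstep2
    _ ≤ ENNReal.ofReal (P * ∫ t in Ioo 0 T, ∫ x, |g t x|) := ENNReal.ofReal_le_ofReal hstep3
    _ = ENNReal.ofReal P * ∫⁻ t in Ioo 0 T, ∫⁻ x, ‖g t x‖ₑ := hstep4

end Integrated

end Literature.Analysis.FluidPDE
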